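import Mathlib
import Summits.Ventures.HodgeRepro.Tier4.Line4.LocalBlocks

/-!
# Tier4/Line4/SliceModel — the local unitary group of the row plane at a real CM place IS `U(J)`:
`localUnitary (ofLinesRow q a b ε) w₀ ≃ₜ* UJ a_{w₀} (ε b)_{w₀}`, and the size comparison `ℓ¹ ∘ locOf ≤ (1 + ‖ω‖) ℓ¹`

Blind re-derivation cell `pub-hodge-repro`, Tier 4 «prove the step» (README §9–§10), seat t4-L4-p2 (prover, LINE L4,
gen 5; cut C2 of C-COMMON-SL2BALL stage C, statement S15613 (M2), part b).  Tree path
`lean/Summits/Ventures/HodgeRepro/Tier4/Line4/SliceModel.lean`.  Mathlib-level; no literature.  Imports this seat's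
`Line4/LocalBlocks` (`blocksOfR`, `ScalarUnitary`, `mem_localUnitary_ofLinesRow_iff`; through it `LocalAssembly`,
typer-2's `LocalUnitary` / `LocalCoordinates` / `RowWeights` (`wroot`, `wroot_sq`, `conj_wroot`,
`extensionEmbedding_im_eq_zero`) and `UnitaryHyperbolic` is NOT needed: the `U(J)` side is the companion module
`Line4/SliceModelUnitary` (the 400-line rule splits the model).

THE MODEL.  At a real place `w₀` of `k` the completion `k_{w₀}` is `ℝ` (`Φ := ringEquivRealOfIsReal hw`, an isometry;
`ι := extensionEmbedding w₀ : k_{w₀} →+* ℂ` is `Φ` followed by `ℝ ⊆ ℂ`).  At a real CM place (`IsCMAt q w₀`: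
`t_{w₀}² < 4 n_{w₀}`) the root `ω = wroot q w₀` of `X² − t X + n` has `Im ω > 0`, so `bw x y := ι x + ι y · ω` is an
`ℝ`-linear BIJECTION `k_{w₀}² → ℂ` (`realOf` is its inverse) with `bw (z z′) = bw z · bw z′` and
`bw (z z̄′) = bw z · conj (bw z′)` for the block products of `RowTorus`/`LocalUnitary`.  Reading the four blocks
`x_{IJ} + y_{IJ} ω` of `m ∈ U(W)(k_{w₀})` through `bw` gives `locOf m ∈ M₂(ℂ)` (= typer-2's `locMat` on the adelic side:
`locMat q a b ε w₀ g = locOf (componentAt g)`), and the scalar unitarity equations of `LocalBlocks` become exactly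
`locOf m · J · (locOf m)ᴴ = J`, `J = diag (a_{w₀}, (ε b)_{w₀})` (`scalarUnitary_iff_locOf`, companion module).
`blocksMat` reassembles the `4 × 4` matrix from a `2 × 2` complex one; THIS module proves that the two are mutually
inverse (`locOf_blocksMat`, `blocksMat_locOf` on `ω`-linear matrices), that `locOf` is multiplicative (`locOf_mul`) and
continuous (`continuous_locOf`); the companion module (`blocksMat_mul`, `continuous_blocksMat`) assembles

  **`localModel : localUnitary (ofLinesRow q a b ε) w₀ ≃ₜ* UJ (Φ a_{w₀}) (Φ (ε b)_{w₀})`**.  SIGNS: `U(J)` has signature `(1,1)` when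
`a_{w₀} > 0 > (ε b)_{w₀}` — on the line's mixed plane (`ε = −1`) this is the (7a) side's `_hpos` / `IsCMAt` data at the
ONE indefinite real place `w₀` (the seesaw plane's lines `a₀, a₂` both positive at `w₀`); the equivalence itself needs no
sign.  SIZE: `norm_bw_le` — `‖ι x + ι y ω‖ ≤ (1 + ‖ω‖)(‖ι x‖ + ‖ι y‖)`, the entrywise input of the companion's
`l1C_locOf_le`.

Consumer: `Line4/SliceModelUnitary`, then `Line4/SliceBallGrowth` (stage C: `atPlace W w₀ ≃ₜ* U(J)` = `sliceEquiv.trans localModel`; Haar measures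
correspond; typer-2's `haar_logSublevel_le_exp_UJ` transports to `SliceBallGrowth`).

Nothing here says anything about the status of the Hodge conjecture for CM abelian varieties, which is NOT proved
(HC_CM is NOT proved by anyone in this repository).
-/

set_option autoImplicit false

noncomputable section

namespace Summit.Ventures.HodgeRepro.Tier4.Line4

open Summit.Ventures.HodgeRepro.Tier4.Common NumberField Matrix Topology
open scoped ComplexConjugate

section Real

variable {k : Type} [Field k] [NumberField k] (q : QuadData k) {w₀ : InfinitePlace k}

/-- The complex reading of `k_{w₀}` (Mathlib's `extensionEmbedding`). -/
abbrev iota (w₀ : InfinitePlace k) : w₀.Completion →+* ℂ := InfinitePlace.Completion.extensionEmbedding w₀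

omit [NumberField k] in
/-- `ι` is continuous. -/
theorem continuous_iota (w₀ : InfinitePlace k) : Continuous (iota w₀) :=
  (InfinitePlace.Completion.isometry_extensionEmbedding w₀).continuous

omit [NumberField k] in
/-- At a real place `ι x` is the real number `Φ x`. -/
theorem iota_eq_ofReal (hw : w₀.IsReal) (x : w₀.Completion) :
    iota w₀ x = ((InfinitePlace.Completion.ringEquivRealOfIsReal hw x : ℝ) : ℂ) :=
  (InfinitePlace.Completion.extensionEmbeddingOfIsReal_apply hw x).symm

omit [NumberField k] in
/-- At a real place `ι x` is real. -/
theorem iota_im (hw : w₀.IsReal) (x : w₀.Completion) : (iota w₀ x).im = 0 :=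
  extensionEmbedding_im_eq_zero hw x

omit [NumberField k] in
/-- At a real place `conj (ι x) = ι x`. -/
theorem conj_iota (hw : w₀.IsReal) (x : w₀.Completion) : conj (iota w₀ x) = iota w₀ x :=
  Complex.conj_eq_iff_im.2 (iota_im hw x)

omit [NumberField k] in
/-- `ι t = t_{w₀}`. -/
theorem iota_tLoc : iota w₀ (tLoc q w₀) = tAt q w₀ := rfl

omit [NumberField k] in
/-- `ι n = n_{w₀}`. -/
theorem iota_nLoc : iota w₀ (nLoc q w₀) = nAt q w₀ := rfl

omit [NumberField k] in
/-- **`Im ω > 0` at a real CM place** (`ω = (t_w + i √(4 n_w − t_w²)) / 2`). -/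
theorem wroot_im_pos (hw : w₀.IsReal) (hcm : IsCMAt q w₀) : 0 < (wroot q w₀).im := by
  rw [wroot_eq]
  have ht : (tAt q w₀).im = 0 := extensionEmbedding_im_eq_zero hw _
  have hpos : 0 < Real.sqrt (4 * (nAt q w₀).re - (tAt q w₀).re ^ 2) :=
    Real.sqrt_pos.2 (by unfold IsCMAt at hcm; linarith)
  simp only [Complex.div_ofNat_im, Complex.add_im, ht, Complex.mul_im, Complex.I_re, Complex.I_im,
    Complex.ofReal_re, Complex.ofReal_im, one_mul, zero_add, mul_zero]
  positivity

/-- **The block weight** `bw x y = ι x + ι y · ω`: the complex number represented by the block `x + y ω`. -/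
def bw (w₀ : InfinitePlace k) (x y : w₀.Completion) : ℂ := iota w₀ x + iota w₀ y * wroot q w₀

omit [NumberField k] in
/-- `bw` is additive. -/
theorem bw_add (x y x' y' : w₀.Completion) : bw q w₀ (x + x') (y + y') = bw q w₀ x y + bw q w₀ x' y' := by
  simp only [bw, map_add]
  ring

omit [NumberField k] in
/-- `bw` of a difference. -/
theorem bw_sub (x y x' y' : w₀.Completion) : bw q w₀ (x - x') (y - y') = bw q w₀ x y - bw q w₀ x' y' := by
  simp only [bw, map_sub]
  ring

omit [NumberField k] in
/-- `bw` of a scalar multiple. -/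
theorem bw_smul (c x y : w₀.Completion) : bw q w₀ (c * x) (c * y) = iota w₀ c * bw q w₀ x y := by
  simp only [bw, map_mul]
  ring

omit [NumberField k] in
/-- **`bw` is multiplicative on the block product** `(x + y ω)(x′ + y′ ω) = (x x′ − n y y′) + (x y′ + y x′ + t y y′) ω`
(`ω² = t ω − n`). -/
theorem bw_mul (hw : w₀.IsReal) (hcm : IsCMAt q w₀) (x y x' y' : w₀.Completion) :
    bw q w₀ (x * x' - nLoc q w₀ * y * y') (x * y' + y * x' + tLoc q w₀ * y * y') = bw q w₀ x y * bw q w₀ x' y' := by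
  simp only [bw, map_add, map_sub, map_mul, iota_tLoc, iota_nLoc]
  have hsq := wroot_sq hw hcm
  linear_combination (-(iota w₀ y * iota w₀ y')) * hsq

omit [NumberField k] in
/-- **`bw` of the conjugate product** `z z̄′ = (x x′ + n y y′ + t x y′) + (y x′ − x y′) ω` is `bw z · conj (bw z′)`. -/
theorem bw_mul_conj (hw : w₀.IsReal) (hcm : IsCMAt q w₀) (x y x' y' : w₀.Completion) :
    bw q w₀ (x * x' + nLoc q w₀ * y * y' + tLoc q w₀ * x * y') (y * x' - x * y') =
      bw q w₀ x y * conj (bw q w₀ x' y') := by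
  simp only [bw, map_add, map_sub, map_mul, iota_tLoc, iota_nLoc, conj_iota hw, conj_wroot hw]
  have hsq := wroot_sq hw hcm
  linear_combination (iota w₀ y * iota w₀ y') * hsq

omit [NumberField k] in
/-- The real part of `bw x y`. -/
theorem bw_re (hw : w₀.IsReal) (x y : w₀.Completion) :
    (bw q w₀ x y).re = InfinitePlace.Completion.ringEquivRealOfIsReal hw x +
      InfinitePlace.Completion.ringEquivRealOfIsReal hw y * (wroot q w₀).re := by
  simp only [bw, Complex.add_re, Complex.mul_re, iota_eq_ofReal hw, Complex.ofReal_re, Complex.ofReal_im, zero_mul,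
    sub_zero]

omit [NumberField k] in
/-- The imaginary part of `bw x y`. -/
theorem bw_im (hw : w₀.IsReal) (x y : w₀.Completion) :
    (bw q w₀ x y).im = InfinitePlace.Completion.ringEquivRealOfIsReal hw y * (wroot q w₀).im := by
  simp only [bw, Complex.add_im, Complex.mul_im, iota_eq_ofReal hw, Complex.ofReal_re, Complex.ofReal_im, zero_mul,
    add_zero, zero_add]

omit [NumberField k] in
/-- **`bw` is injective**: `bw x y = 0 → x = 0 ∧ y = 0` (`Im ω ≠ 0`). -/
theorem eq_zero_of_bw_eq_zero (hw : w₀.IsReal) (hcm : IsCMAt q w₀) {x y : w₀.Completion}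
    (h : bw q w₀ x y = 0) : x = 0 ∧ y = 0 := by
  have him := congrArg Complex.im h
  rw [bw_im q hw, Complex.zero_im] at him
  have hy : InfinitePlace.Completion.ringEquivRealOfIsReal hw y = 0 :=
    (mul_eq_zero.1 him).resolve_right (wroot_im_pos q hw hcm).ne'
  have hy0 : y = 0 := (InfinitePlace.Completion.ringEquivRealOfIsReal hw).injective (by rw [hy, map_zero])
  have hre := congrArg Complex.re h
  rw [bw_re q hw, Complex.zero_re, hy, zero_mul, add_zero] at hre
  exact ⟨(InfinitePlace.Completion.ringEquivRealOfIsReal hw).injective (by rw [hre, map_zero]), hy0⟩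

omit [NumberField k] in
/-- `bw` is injective (as a map of pairs). -/
theorem bw_injective (hw : w₀.IsReal) (hcm : IsCMAt q w₀) {x y x' y' : w₀.Completion}
    (h : bw q w₀ x y = bw q w₀ x' y') : x = x' ∧ y = y' := by
  have h0 : bw q w₀ (x - x') (y - y') = 0 := by rw [bw_sub, h, sub_self]
  obtain ⟨h1, h2⟩ := eq_zero_of_bw_eq_zero q hw hcm h0
  exact ⟨sub_eq_zero.1 h1, sub_eq_zero.1 h2⟩

/-- **The inverse of `bw`**: the real coordinates `(x, y)` of `z = x + y ω` (`y = Im z / Im ω`, `x = Re z − y Re ω`). -/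
def realOf (hw : w₀.IsReal) (z : ℂ) : w₀.Completion × w₀.Completion :=
  ((InfinitePlace.Completion.ringEquivRealOfIsReal hw).symm (z.re - z.im / (wroot q w₀).im * (wroot q w₀).re),
    (InfinitePlace.Completion.ringEquivRealOfIsReal hw).symm (z.im / (wroot q w₀).im))

omit [NumberField k] in
/-- `bw ∘ realOf = id`. -/
theorem bw_realOf (hw : w₀.IsReal) (hcm : IsCMAt q w₀) (z : ℂ) :
    bw q w₀ (realOf q hw z).1 (realOf q hw z).2 = z := by
  have hne : (wroot q w₀).im ≠ 0 := (wroot_im_pos q hw hcm).ne'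
  apply Complex.ext
  · rw [bw_re q hw]
    simp only [realOf, RingEquiv.apply_symm_apply]
    field_simp
    ring
  · rw [bw_im q hw]
    simp only [realOf, RingEquiv.apply_symm_apply]
    field_simp

omit [NumberField k] in
/-- `realOf ∘ bw = id`. -/
theorem realOf_bw (hw : w₀.IsReal) (hcm : IsCMAt q w₀) (x y : w₀.Completion) :
    realOf q hw (bw q w₀ x y) = (x, y) := by
  have h := bw_realOf q hw hcm (bw q w₀ x y)
  obtain ⟨h1, h2⟩ := bw_injective q hw hcm h
  exact Prod.ext h1 h2

omit [NumberField k] in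
/-- `realOf` is continuous. -/
theorem continuous_realOf (hw : w₀.IsReal) : Continuous (realOf q hw) := by
  have hc : Continuous (InfinitePlace.Completion.ringEquivRealOfIsReal hw).symm :=
    (InfinitePlace.Completion.isometryEquivRealOfIsReal hw).symm.continuous
  refine Continuous.prodMk (hc.comp ?_) (hc.comp ?_)
  · exact Complex.continuous_re.sub ((Complex.continuous_im.div_const _).mul continuous_const)
  · exact Complex.continuous_im.div_const _

omit [NumberField k] in
/-- The norm of `bw x y` is at most `(1 + ‖ω‖) (‖ι x‖ + ‖ι y‖)`. -/
theorem norm_bw_le (x y : w₀.Completion) :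
    ‖bw q w₀ x y‖ ≤ (1 + ‖wroot q w₀‖) * (‖iota w₀ x‖ + ‖iota w₀ y‖) := by
  have h1 : ‖bw q w₀ x y‖ ≤ ‖iota w₀ x‖ + ‖iota w₀ y‖ * ‖wroot q w₀‖ := by
    unfold bw
    exact (norm_add_le _ _).trans (by rw [norm_mul])
  have hx := norm_nonneg (iota w₀ x)
  have hy := norm_nonneg (iota w₀ y)
  have hω := norm_nonneg (wroot q w₀)
  nlinarith

end Real

/-! ## 2. The complex reading of a `4 × 4` matrix and the reassembly -/

section Model

variable {k : Type} [Field k] [NumberField k] (q : QuadData k) (a b ε : k) {w₀ : InfinitePlace k}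

/-- **The complex `2 × 2` reading** of a `4 × 4` matrix over `k_{w₀}`: entry `(I, J)` is `bw` of the two entries of
the block (`x = M (lineBase I) (lineBase J)`, `y = M (lineOmega I) (lineBase J)`). -/
def locOf (w₀ : InfinitePlace k) (M : Matrix (Fin 4) (Fin 4) w₀.Completion) : Matrix (Fin 2) (Fin 2) ℂ :=
  fun I J => bw q w₀ (M (lineBase I) (lineBase J)) (M (lineOmega I) (lineBase J))

omit [NumberField k] in
/-- `locOf` entrywise. -/
theorem locOf_apply (M : Matrix (Fin 4) (Fin 4) w₀.Completion) (I J : Fin 2) :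
    locOf q w₀ M I J = bw q w₀ (M (lineBase I) (lineBase J)) (M (lineOmega I) (lineBase J)) := rfl

omit [NumberField k] in
/-- `locOf` is continuous. -/
theorem continuous_locOf : Continuous (locOf q w₀) := by
  refine continuous_matrix fun I J => ?_
  simp only [locOf_apply, bw]
  exact ((continuous_iota w₀).comp (continuous_apply_apply _ _)).add
    (((continuous_iota w₀).comp (continuous_apply_apply _ _)).mul continuous_const)

/-- **The reassembly**: the `4 × 4` matrix over `k_{w₀}` with blocks `x_{IJ} + y_{IJ} ω`, `(x_{IJ}, y_{IJ}) = realOf (m I J)`. -/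
def blocksMat (hw : w₀.IsReal) (m : Matrix (Fin 2) (Fin 2) ℂ) : Matrix (Fin 4) (Fin 4) w₀.Completion :=
  re4R (fromBlocks
    (blockOf (tLoc q w₀) (nLoc q w₀) (realOf q hw (m 0 0)).1 (realOf q hw (m 0 0)).2)
    (blockOf (tLoc q w₀) (nLoc q w₀) (realOf q hw (m 0 1)).1 (realOf q hw (m 0 1)).2)
    (blockOf (tLoc q w₀) (nLoc q w₀) (realOf q hw (m 1 0)).1 (realOf q hw (m 1 0)).2)
    (blockOf (tLoc q w₀) (nLoc q w₀) (realOf q hw (m 1 1)).1 (realOf q hw (m 1 1)).2))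

omit [NumberField k] in
/-- The blocks of `blocksMat m`. -/
theorem blocksOfR_blocksMat (hw : w₀.IsReal) (m : Matrix (Fin 2) (Fin 2) ℂ) (I J : Fin 2) :
    blocksOfR (blocksMat q hw m) I J =
      blockOf (tLoc q w₀) (nLoc q w₀) (realOf q hw (m I J)).1 (realOf q hw (m I J)).2 := by
  obtain ⟨h00, h01, h10, h11⟩ := blocksOfR_re4R_fromBlocks
    (blockOf (tLoc q w₀) (nLoc q w₀) (realOf q hw (m 0 0)).1 (realOf q hw (m 0 0)).2)
    (blockOf (tLoc q w₀) (nLoc q w₀) (realOf q hw (m 0 1)).1 (realOf q hw (m 0 1)).2)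
    (blockOf (tLoc q w₀) (nLoc q w₀) (realOf q hw (m 1 0)).1 (realOf q hw (m 1 0)).2)
    (blockOf (tLoc q w₀) (nLoc q w₀) (realOf q hw (m 1 1)).1 (realOf q hw (m 1 1)).2)
  fin_cases I <;> fin_cases J
  · exact h00
  · exact h01
  · exact h10
  · exact h11

omit [NumberField k] in
/-- The `(lineBase I, lineBase J)` entry of `blocksMat m` is the first coordinate of `realOf (m I J)`. -/
theorem blocksMat_apply_base (hw : w₀.IsReal) (m : Matrix (Fin 2) (Fin 2) ℂ) (I J : Fin 2) :
    blocksMat q hw m (lineBase I) (lineBase J) = (realOf q hw (m I J)).1 := by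
  have h := blocksOfR_apply_zero_zero (blocksMat q hw m) I J
  rw [blocksOfR_blocksMat, blockOf_apply_zero_zero] at h
  exact h.symm

omit [NumberField k] in
/-- The `(lineOmega I, lineBase J)` entry of `blocksMat m` is the second coordinate of `realOf (m I J)`. -/
theorem blocksMat_apply_omega (hw : w₀.IsReal) (m : Matrix (Fin 2) (Fin 2) ℂ) (I J : Fin 2) :
    blocksMat q hw m (lineOmega I) (lineBase J) = (realOf q hw (m I J)).2 := by
  have h := blocksOfR_apply_one_zero (blocksMat q hw m) I J
  rw [blocksOfR_blocksMat, blockOf_apply_one_zero] at h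
  exact h.symm

omit [NumberField k] in
/-- The blocks of `blocksMat m` are of the form `blockOf` of its own entries. -/
theorem blocksOfR_blocksMat_eq_blockOf (hw : w₀.IsReal) (m : Matrix (Fin 2) (Fin 2) ℂ) (I J : Fin 2) :
    blocksOfR (blocksMat q hw m) I J =
      blockOf (tLoc q w₀) (nLoc q w₀) (blocksMat q hw m (lineBase I) (lineBase J))
        (blocksMat q hw m (lineOmega I) (lineBase J)) := by
  rw [blocksOfR_blocksMat, blocksMat_apply_base, blocksMat_apply_omega]

omit [NumberField k] in
/-- **`locOf ∘ blocksMat = id`.** -/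
theorem locOf_blocksMat (hw : w₀.IsReal) (hcm : IsCMAt q w₀) (m : Matrix (Fin 2) (Fin 2) ℂ) :
    locOf q w₀ (blocksMat q hw m) = m := by
  ext I J
  rw [locOf_apply, blocksMat_apply_base, blocksMat_apply_omega, bw_realOf q hw hcm]

/-- The local `Ω` of the row plane, `blockDiag (ω, ω)` over `k_{w₀}` (`omegaAt_ofLinesRow`). -/
abbrev omegaLoc (w₀ : InfinitePlace k) : Matrix (Fin 4) (Fin 4) w₀.Completion :=
  re4R (fromBlocks (omegaMatR (tLoc q w₀) (nLoc q w₀)) 0 0 (omegaMatR (tLoc q w₀) (nLoc q w₀)))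

/-- A `4 × 4` matrix over `k_{w₀}` is **`ω`-linear** when it commutes with `blockDiag (ω, ω)` — equivalently
(`blocks_eq_blockOf_of_comm`) its blocks are `x + y ω` of its own entries. -/
def IsOmegaLinear (w₀ : InfinitePlace k) (M : Matrix (Fin 4) (Fin 4) w₀.Completion) : Prop :=
  M * omegaLoc q w₀ = omegaLoc q w₀ * M

omit [NumberField k] in
/-- The blocks of an `ω`-linear matrix. -/
theorem IsOmegaLinear.blocks {M : Matrix (Fin 4) (Fin 4) w₀.Completion} (hM : IsOmegaLinear q w₀ M) (I J : Fin 2) :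
    blocksOfR M I J = blockOf (tLoc q w₀) (nLoc q w₀) (M (lineBase I) (lineBase J)) (M (lineOmega I) (lineBase J)) :=
  blocks_eq_blockOf_of_comm _ _ hM I J

omit [NumberField k] in
/-- Products of `ω`-linear matrices are `ω`-linear. -/
theorem IsOmegaLinear.mul {M N : Matrix (Fin 4) (Fin 4) w₀.Completion} (hM : IsOmegaLinear q w₀ M)
    (hN : IsOmegaLinear q w₀ N) : IsOmegaLinear q w₀ (M * N) := by
  unfold IsOmegaLinear at *
  rw [Matrix.mul_assoc, hN, ← Matrix.mul_assoc, hM, Matrix.mul_assoc]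

omit [NumberField k] in
/-- `1` is `ω`-linear. -/
theorem isOmegaLinear_one : IsOmegaLinear q w₀ (1 : Matrix (Fin 4) (Fin 4) w₀.Completion) := by
  unfold IsOmegaLinear
  rw [Matrix.one_mul, Matrix.mul_one]

omit [NumberField k] in
/-- `blocksMat m` is `ω`-linear. -/
theorem isOmegaLinear_blocksMat (hw : w₀.IsReal) (m : Matrix (Fin 2) (Fin 2) ℂ) :
    IsOmegaLinear q w₀ (blocksMat q hw m) :=
  comm_of_blocks_eq_blockOf _ _ (fun I J => (realOf q hw (m I J)).1) (fun I J => (realOf q hw (m I J)).2)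
    (fun I J => blocksOfR_blocksMat q hw m I J)

omit [NumberField k] in
/-- **`blocksMat ∘ locOf = id` on `ω`-linear matrices.** -/
theorem blocksMat_locOf (hw : w₀.IsReal) (hcm : IsCMAt q w₀) {M : Matrix (Fin 4) (Fin 4) w₀.Completion}
    (hM : IsOmegaLinear q w₀ M) : blocksMat q hw (locOf q w₀ M) = M := by
  conv_rhs => rw [eq_re4R_fromBlocks_blocksOfR M]
  unfold blocksMat
  congr 1
  simp only [locOf_apply, realOf_bw q hw hcm, IsOmegaLinear.blocks q hM 0 0, IsOmegaLinear.blocks q hM 0 1,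
    IsOmegaLinear.blocks q hM 1 0, IsOmegaLinear.blocks q hM 1 1]

omit [NumberField k] in
/-- **`locOf` is multiplicative on `ω`-linear matrices.** -/
theorem locOf_mul (hw : w₀.IsReal) (hcm : IsCMAt q w₀) {M N : Matrix (Fin 4) (Fin 4) w₀.Completion}
    (hM : IsOmegaLinear q w₀ M) (hN : IsOmegaLinear q w₀ N) :
    locOf q w₀ (M * N) = locOf q w₀ M * locOf q w₀ N := by
  ext I J
  have hb : blocksOfR (M * N) I J =
      blockOf (tLoc q w₀) (nLoc q w₀)
        (M (lineBase I) (lineBase 0) * N (lineBase 0) (lineBase J) -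
            nLoc q w₀ * M (lineOmega I) (lineBase 0) * N (lineOmega 0) (lineBase J) +
          (M (lineBase I) (lineBase 1) * N (lineBase 1) (lineBase J) -
            nLoc q w₀ * M (lineOmega I) (lineBase 1) * N (lineOmega 1) (lineBase J)))
        (M (lineBase I) (lineBase 0) * N (lineOmega 0) (lineBase J) +
            M (lineOmega I) (lineBase 0) * N (lineBase 0) (lineBase J) +
            tLoc q w₀ * M (lineOmega I) (lineBase 0) * N (lineOmega 0) (lineBase J) +
          (M (lineBase I) (lineBase 1) * N (lineOmega 1) (lineBase J) +
            M (lineOmega I) (lineBase 1) * N (lineBase 1) (lineBase J) +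
            tLoc q w₀ * M (lineOmega I) (lineBase 1) * N (lineOmega 1) (lineBase J))) := by
    rw [blocksOfR_mul, IsOmegaLinear.blocks q hM, IsOmegaLinear.blocks q hM, IsOmegaLinear.blocks q hN,
      IsOmegaLinear.blocks q hN, blockOf_mul, blockOf_mul, blockOf_add]
  have h00 := congrFun (congrFun hb 0) 0
  have h10 := congrFun (congrFun hb 1) 0
  rw [blocksOfR_apply_zero_zero, blockOf_apply_zero_zero] at h00
  rw [blocksOfR_apply_one_zero, blockOf_apply_one_zero] at h10
  rw [Matrix.mul_apply, Fin.sum_univ_two, locOf_apply, locOf_apply, locOf_apply, locOf_apply, locOf_apply, h00, h10,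
    bw_add, bw_mul q hw hcm, bw_mul q hw hcm]

omit [NumberField k] in
/-- **`locOf 1 = 1`.** -/
theorem locOf_one : locOf q w₀ (1 : Matrix (Fin 4) (Fin 4) w₀.Completion) = 1 := by
  ext I J
  fin_cases I <;> fin_cases J <;> simp [locOf_apply, bw, lineBase, lineOmega, Fin.ext_iff]

end Model

end Summit.Ventures.HodgeRepro.Tier4.Line4

end
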